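import Summits.QuantumFields.YangMills.Theorems.UnitScaleTiltProp7TopMeanAdjointBlockLocal
import HarnessLib

/-!
# Route `UnitScaleTilt`, crux «MinimiserStabilityRegPr» (stmt-QuantumFields-19200, stub EX), positivity block, the LOD ∕ Combes–Thomas line (★★OWNER RULINGS №33 ∕ №34; brick (L3′a)
# «L² Agmon row of `G_a = (Δ_U + aQ″†Q″)⁻¹`», px5 g11's LOCATE-L3a letter risk (γ)) — **THE SITE⊗ENTRY ORTHONORMAL COORDINATES OF THE WEIGHTED `L²` OF THE GAUGE PARAMETERS, AND THE
# GENERIC BRIDGE FROM AN OPERATOR ON A FINITE-DIMENSIONAL HILBERT SPACE TO THE MATRIX LETTERS OF THE COMBES–THOMAS ENGINES** (width seat `ym3-torus-px17` gen 8, 2026-08-29)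

Cell `ym3-torus` (HUMAN RULING D-0037: YM₃ on T³ is ladder rung R3 — NOT d = 4, NOT infinite volume, NOT a mass gap, NOT Clay).  THEOREMS ONLY (0 `def`, 0 `sorry`);
`--supports stmt-QuantumFields-19200 --as helper`, count-neutral.  HONEST LABEL (№33 (6) ∕ №34): engine-side letters of the curved γ-row supplier line (LOD localisation; «no
RANDOM-WALK organ; ONE Thm 3.1-class Agmon brick (L3′) inside, Track A road cited»); nothing of (L3′a)'s member budget check, (3.49), Thm 3.1 ∕ 3.3, `h349`, `hGF`, EX or the crux is
proved here.

THE POINT.  The Combes–Thomas engines of the line (✓`Prop7ProjRangeKernelDecayCT`, ✓`Prop7AccretiveConjDecay`, ✓`Prop7HermitianCoshBudgetCT`) speak MATRIX letters: `A : Matrix n n ℂ`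
Hermitian, `m`-accretive as `m·Σ_i‖v i‖² ≤ Re Σ_i v̄_i (A v)_i`, with entry budgets.  The member operator `Δ_{U₀} + aQ″†Q″` lives on the weighted `L²` of the gauge parameters
`SiteL2K ℂ 3 (periodsT3 F K) c₀ W₂` (✓`Prop7SectET3HilbertLetters`: `toL2S`, pairing ✓`inner_toL2S` `= c₀·Σ_x tr(λ(x)ᴴμ(x))`).  §1 supplies the site⊗entry ORTHONORMAL family
`(x,(j,k)) ↦ (√c₀)⁻¹·toL2S(δ_x ⊗ E_{jk})` as two PROPOSITIONS (`Orthonormal`, `⊤ ≤ span`) so that consumers obtain Mathlib's `OrthonormalBasis.mk` (data) inline and read any operator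
through `LinearMap.toMatrixOrthonormal` (a ⋆-algebra equivalence: adjoints ↦ `ᴴ`, products and inverses transported); §2 is the carrier-free bridge (any finite-dimensional complex
inner-product space, any orthonormal basis): symmetric ↦ Hermitian, the quadratic form `Re⟪u, Au⟫` ↦ `Re Σ v̄_i(Mv)_i` on coefficient vectors, coercive ↦ accretive, and the
Cauchy–Schwarz entry bound.  The `covLapSite` entry ∕ range rows in these coordinates are the sequel file.

WHAT IS PROVED (ns `…Theorems.Prop7SiteEntryCoordinates`).
* §1 (T³ member, weight `c₀ > 0`): `trace_conjTranspose_single_one_mul` (`tr(E_{jk}ᴴ g) = g_{jk}`), `inner_toL2S_single_one_left` (`⟪toL2S(δ_x⊗E_{jk}), toL2S g⟫ = c₀·g x j k`),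
  `inner_rawSpike_rawSpike` (Gram matrix `c₀·𝟙`), ★`orthonormal_spike`, ★`top_le_span_spike`, `inner_spike_toL2S` (coordinates `√c₀·g x j k`), `toL2S_symm_eq_zero_of_inner_rawSpike`.
* §2 (generic `E`, `b : OrthonormalBasis ι ℂ E`, `A : E →ₗ[ℂ] E`, `M = LinearMap.toMatrixOrthonormal b A`): ★`isHermitian_toMatrixOrthonormal_of_isSymmetric`,
  ★`sum_star_mul_toMatrix_mulVec_eq_inner` (`Σ_i v̄_i (M v)_i = ⟪Σ v_i b_i, A(Σ v_i b_i)⟫`), `norm_sq_sum_smul_orthonormalBasis`, ★★`accretive_toMatrixOrthonormal_of_coercive`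
  (`(∀ u, m‖u‖² ≤ Re⟪u,Au⟫) → ∀ v, m·Σ‖v i‖² ≤ Re Σ v̄_i(Mv)_i` — the `hacc` row of ✓`inv_decay_of_hermitian_coshBudget`), `norm_toMatrixOrthonormal_apply_le` (`‖M i l‖ ≤ ‖A (b l)‖`).
HONEST SCOPE.  Linear-algebra bookkeeping; no estimate on any member operator; nothing continuum ∕ OS ∕ mass-gap ∕ Clay.

References: T. Bałaban, CMP **99** (1985) 389–434 [Balaban1985BackgroundPropagators] ((3.11) p.392 the `L²` pairing, (3.23)–(3.25) p.394, (3.49) p.399); CMP **98** (1985) 17–51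
[Balaban1985Averaging] ((18)–(19) p.21, the two normings of the fibre).
-/

set_option autoImplicit false

noncomputable section

open scoped BigOperators InnerProductSpace ComplexConjugate Matrix

namespace Summit.QuantumFields.YangMills.Theorems.Prop7SiteEntryCoordinates

open Literature.MathematicalPhysics.QuantumFieldTheory.Balaban1983to89
open Literature.MathematicalPhysics.QuantumFieldTheory.Balaban1983to89.T3ContinuumYM3Torus
open B9Eq311L2Pairing (WL2)
open B11Eq103H1Complex (SiteL2K)
open Summit.QuantumFields.YangMills.Theorems.Prop7SectET3Transport (periodsT3)
open Summit.QuantumFields.YangMills.Theorems.Prop7SectET3HilbertLetters (W₂ toL2S)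
open Summit.QuantumFields.YangMills.Theorems.Prop7SectET3RealCoordSums (inner_toL2S)
open Summit.QuantumFields.YangMills.Theorems.Prop7TopMeanAdjointBlockLocal (inner_toL2S_single_left)

/-! ## §1 The site⊗entry spikes: Gram matrix, orthonormality, spanning, coordinates -/

section Spikes

variable (F : T3Family) {K : ℕ} {c₀ : ℝ} [Fact (0 < c₀)]

omit [Fact (0 < c₀)] in
/-- `tr(E_{jk}ᴴ · g) = g_{jk}` for the matrix unit `E_{jk} = Matrix.single j k 1`. [folklore] -/
theorem trace_conjTranspose_single_one_mul (j k : Fin 2) (g : Matrix (Fin 2) (Fin 2) ℂ) :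
    Matrix.trace ((Matrix.single j k (1 : ℂ))ᴴ * g) = g j k := by
  rw [Matrix.conjTranspose_single, star_one, Matrix.trace_single_mul, one_smul]

/-- `⟪toL2S(δ_x⊗E_{jk}), toL2S g⟫ = c₀·g(x)_{jk}`: the raw spike reads one coordinate (✓`inner_toL2S_single_left`). [cite: Balaban1985BackgroundPropagators, (3.11) p.392] -/
theorem inner_toL2S_single_one_left (x : Site (F.P K) 0) (j k : Fin 2) (g : Site (F.P K) 0 → Matrix (Fin 2) (Fin 2) ℂ) :
    ⟪toL2S F K c₀ (Pi.single x (Matrix.single j k (1 : ℂ))), toL2S F K c₀ g⟫_ℂ = (c₀ : ℂ) * g x j k := by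
  rw [inner_toL2S_single_left, trace_conjTranspose_single_one_mul]

/-- **GRAM MATRIX OF THE RAW SPIKES**: `⟪toL2S(δ_x⊗E_{jk}), toL2S(δ_{x′}⊗E_{j′k′})⟫ = c₀·[x = x′][j = j′][k = k′]`. [cite: Balaban1985BackgroundPropagators, (3.11) p.392] -/
theorem inner_rawSpike_rawSpike (x x' : Site (F.P K) 0) (j k j' k' : Fin 2) :
    ⟪toL2S F K c₀ (Pi.single x (Matrix.single j k (1 : ℂ))), toL2S F K c₀ (Pi.single x' (Matrix.single j' k' (1 : ℂ)))⟫_ℂ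
      = if x = x' ∧ j = j' ∧ k = k' then (c₀ : ℂ) else 0 := by
  rw [inner_toL2S_single_one_left]
  by_cases hx : x = x'
  · subst hx
    rw [Pi.single_eq_same, Matrix.single_apply]
    by_cases hjk : j' = j ∧ k' = k
    · rw [if_pos hjk, if_pos ⟨rfl, hjk.1.symm, hjk.2.symm⟩, mul_one]
    · rw [if_neg hjk, mul_zero, if_neg]
      rintro ⟨-, h1, h2⟩
      exact hjk ⟨h1.symm, h2.symm⟩
  · rw [Pi.single_eq_of_ne hx, Matrix.zero_apply, mul_zero, if_neg]
    rintro ⟨h, -⟩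
    exact hx h

/-- ★ **THE NORMALISED SITE⊗ENTRY SPIKES ARE ORTHONORMAL**: `(x,(j,k)) ↦ (√c₀)⁻¹·toL2S(δ_x⊗E_{jk})` is an orthonormal family of `SiteL2K ℂ 3 (periodsT3 F K) c₀ W₂`.
[cite: Balaban1985BackgroundPropagators, (3.11) p.392; Balaban1985Averaging, (18) p.21] -/
theorem orthonormal_spike :
    Orthonormal ℂ (fun i : Site (F.P K) 0 × (Fin 2 × Fin 2) =>
      (((Real.sqrt c₀ : ℝ) : ℂ))⁻¹ • toL2S F K c₀ (Pi.single i.1 (Matrix.single i.2.1 i.2.2 (1 : ℂ)))) := by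
  classical
  have hc : 0 < c₀ := Fact.out
  have hsq : (((Real.sqrt c₀ : ℝ) : ℂ))⁻¹ * (((Real.sqrt c₀ : ℝ) : ℂ))⁻¹ * (c₀ : ℂ) = 1 := by
    rw [← mul_inv, ← Complex.ofReal_mul, Real.mul_self_sqrt hc.le, inv_mul_cancel₀]
    exact_mod_cast hc.ne'
  rw [orthonormal_iff_ite]
  rintro ⟨x, j, k⟩ ⟨x', j', k'⟩
  rw [inner_smul_left, inner_smul_right, inner_rawSpike_rawSpike, ← Complex.ofReal_inv, Complex.conj_ofReal, Complex.ofReal_inv]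
  by_cases h : x = x' ∧ j = j' ∧ k = k'
  · obtain ⟨rfl, rfl, rfl⟩ := h
    rw [if_pos ⟨rfl, rfl, rfl⟩, if_pos rfl, ← mul_assoc, hsq]
  · rw [if_neg h, mul_zero, mul_zero, if_neg]
    intro h'
    simp only [Prod.mk.injEq] at h'
    exact h ⟨h'.1, h'.2.1, h'.2.2⟩

/-- A vector orthogonal to every raw spike vanishes (read back on the route's functions). [cite: Balaban1985BackgroundPropagators, (3.11) p.392] -/
theorem toL2S_symm_eq_zero_of_inner_rawSpike (u : SiteL2K ℂ 3 (periodsT3 F K) c₀ W₂)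
    (hu : ∀ (x : Site (F.P K) 0) (j k : Fin 2), ⟪toL2S F K c₀ (Pi.single x (Matrix.single j k (1 : ℂ))), u⟫_ℂ = 0) :
    (toL2S F K c₀).symm u = 0 := by
  have hc : 0 < c₀ := Fact.out
  obtain ⟨g, rfl⟩ : ∃ g : Site (F.P K) 0 → Matrix (Fin 2) (Fin 2) ℂ, u = toL2S F K c₀ g := ⟨(toL2S F K c₀).symm u, ((toL2S F K c₀).apply_symm_apply u).symm⟩
  rw [LinearEquiv.symm_apply_apply]
  funext x
  ext j k
  have h := hu x j k
  rw [inner_toL2S_single_one_left, mul_eq_zero] at h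
  rcases h with h | h
  · exact absurd (by exact_mod_cast h) hc.ne'
  · rw [h]; rfl

/-- ★ **THE NORMALISED SPIKES SPAN**: `⊤ ≤ span ℂ (range spikes)` — with `orthonormal_spike` this is the input of Mathlib's `OrthonormalBasis.mk`, so every consumer may write
`OrthonormalBasis.mk (orthonormal_spike F) (top_le_span_spike F)` (and `OrthonormalBasis.coe_mk`) without a new definition. [cite: Balaban1985BackgroundPropagators, (3.11) p.392] -/
theorem top_le_span_spike :
    ⊤ ≤ Submodule.span ℂ (Set.range fun i : Site (F.P K) 0 × (Fin 2 × Fin 2) =>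
      (((Real.sqrt c₀ : ℝ) : ℂ))⁻¹ • toL2S F K c₀ (Pi.single i.1 (Matrix.single i.2.1 i.2.2 (1 : ℂ)))) := by
  have hc : 0 < c₀ := Fact.out
  have hsc : (((Real.sqrt c₀ : ℝ) : ℂ)) ≠ 0 := by exact_mod_cast (Real.sqrt_pos.2 hc).ne'
  rw [top_le_iff, ← Submodule.orthogonal_eq_bot_iff, Submodule.eq_bot_iff]
  intro u hu
  rw [Submodule.mem_orthogonal] at hu
  have hraw : ∀ (x : Site (F.P K) 0) (j k : Fin 2), ⟪toL2S F K c₀ (Pi.single x (Matrix.single j k (1 : ℂ))), u⟫_ℂ = 0 := by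
    intro x j k
    have h := hu _ (Submodule.subset_span ⟨(x, (j, k)), rfl⟩)
    rw [inner_smul_left, mul_eq_zero] at h
    rcases h with h | h
    · exact absurd h (by rw [map_eq_zero]; exact inv_ne_zero hsc)
    · exact h
  have h0 := toL2S_symm_eq_zero_of_inner_rawSpike F u hraw
  calc u = toL2S F K c₀ ((toL2S F K c₀).symm u) := ((toL2S F K c₀).apply_symm_apply u).symm
    _ = 0 := by rw [h0, map_zero]

/-- **COORDINATES**: `⟪(√c₀)⁻¹·toL2S(δ_x⊗E_{jk}), toL2S g⟫ = √c₀ · g(x)_{jk}`. [cite: Balaban1985BackgroundPropagators, (3.11) p.392] -/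
theorem inner_spike_toL2S (x : Site (F.P K) 0) (j k : Fin 2) (g : Site (F.P K) 0 → Matrix (Fin 2) (Fin 2) ℂ) :
    ⟪(((Real.sqrt c₀ : ℝ) : ℂ))⁻¹ • toL2S F K c₀ (Pi.single x (Matrix.single j k (1 : ℂ))), toL2S F K c₀ g⟫_ℂ = ((Real.sqrt c₀ : ℝ) : ℂ) * g x j k := by
  have hc : 0 < c₀ := Fact.out
  have hr : (Real.sqrt c₀)⁻¹ * c₀ = Real.sqrt c₀ := by
    rw [inv_mul_eq_div, div_eq_iff (Real.sqrt_pos.2 hc).ne', Real.mul_self_sqrt hc.le]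
  have hc' : ((Real.sqrt c₀ : ℝ) : ℂ)⁻¹ * (c₀ : ℂ) = ((Real.sqrt c₀ : ℝ) : ℂ) := by exact_mod_cast hr
  rw [inner_smul_left, inner_toL2S_single_one_left, map_inv₀, Complex.conj_ofReal, ← mul_assoc, hc']

end Spikes

/-! ## §2 Generic bridge: an operator on a finite-dimensional Hilbert space in an orthonormal basis, in the matrix letters of the Combes–Thomas engines -/

section Bridge

variable {ι E : Type*} [Fintype ι] [DecidableEq ι] [NormedAddCommGroup E] [InnerProductSpace ℂ E] [FiniteDimensional ℂ E]

/-- ★ **SYMMETRIC ⟹ HERMITIAN MATRIX** in any orthonormal basis (`M i l = ⟪b i, A (b l)⟫`, Mathlib `toMatrixOrthonormal_apply_apply`). [folklore] -/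
theorem isHermitian_toMatrixOrthonormal_of_isSymmetric (b : OrthonormalBasis ι ℂ E) {A : E →ₗ[ℂ] E} (hA : A.IsSymmetric) :
    (LinearMap.toMatrixOrthonormal b A).IsHermitian := by
  refine Matrix.IsHermitian.ext fun i l => ?_
  rw [LinearMap.toMatrixOrthonormal_apply_apply, LinearMap.toMatrixOrthonormal_apply_apply, Complex.star_def, inner_conj_symm, hA]

/-- ★ **THE QUADRATIC FORM ON COEFFICIENT VECTORS**: `Σ_i v̄_i·(M v)_i = ⟪Σ_i v_i b_i, A(Σ_i v_i b_i)⟫` — the left side is the form the engines' `hacc` rows use. [folklore] -/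
theorem sum_star_mul_toMatrix_mulVec_eq_inner (b : OrthonormalBasis ι ℂ E) (A : E →ₗ[ℂ] E) (v : ι → ℂ) :
    ∑ i, star (v i) * (LinearMap.toMatrixOrthonormal b A *ᵥ v) i = ⟪∑ i, v i • b i, A (∑ i, v i • b i)⟫_ℂ := by
  rw [map_sum, sum_inner]
  refine Finset.sum_congr rfl fun i _ => ?_
  rw [inner_smul_left, Matrix.mulVec, dotProduct, inner_sum]
  congr 1
  refine Finset.sum_congr rfl fun l _ => ?_
  rw [map_smul, inner_smul_right, LinearMap.toMatrixOrthonormal_apply_apply, mul_comm]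

omit [DecidableEq ι] [FiniteDimensional ℂ E] in
/-- `‖Σ_i v_i b_i‖² = Σ_i ‖v_i‖²` (Parseval in an orthonormal basis). [folklore] -/
theorem norm_sq_sum_smul_orthonormalBasis (b : OrthonormalBasis ι ℂ E) (v : ι → ℂ) : ‖∑ i, v i • b i‖ ^ 2 = ∑ i, ‖v i‖ ^ 2 := by
  rw [@norm_sq_eq_re_inner ℂ, b.orthonormal.inner_sum, map_sum]
  refine Finset.sum_congr rfl fun i _ => ?_
  rw [RCLike.conj_mul, ← RCLike.ofReal_pow, RCLike.ofReal_re]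

/-- ★★ **COERCIVE OPERATOR ⟹ ACCRETIVE MATRIX** (the `hacc` row of ✓`Prop7HermitianCoshBudgetCT.inv_decay_of_hermitian_coshBudget` ∕ ✓`Prop7AccretiveConjDecay`): if `m‖u‖² ≤ Re⟪u, Au⟫`
for every `u`, then `m·Σ_i‖v i‖² ≤ Re Σ_i v̄_i (M v)_i` for every coefficient vector `v`. [folklore] -/
theorem accretive_toMatrixOrthonormal_of_coercive (b : OrthonormalBasis ι ℂ E) (A : E →ₗ[ℂ] E) {m : ℝ} (hA : ∀ u : E, m * ‖u‖ ^ 2 ≤ RCLike.re ⟪u, A u⟫_ℂ)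
    (v : ι → ℂ) : m * ∑ i, ‖v i‖ ^ 2 ≤ (∑ i, star (v i) * (LinearMap.toMatrixOrthonormal b A *ᵥ v) i).re := by
  have h := hA (∑ i, v i • b i)
  rw [norm_sq_sum_smul_orthonormalBasis] at h
  rw [sum_star_mul_toMatrix_mulVec_eq_inner]
  exact h

/-- **ENTRY BOUND BY CAUCHY–SCHWARZ**: `‖M i l‖ ≤ ‖A (b l)‖` (`‖b i‖ = 1`). [folklore] -/
theorem norm_toMatrixOrthonormal_apply_le (b : OrthonormalBasis ι ℂ E) (A : E →ₗ[ℂ] E) (i l : ι) :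
    ‖LinearMap.toMatrixOrthonormal b A i l‖ ≤ ‖A (b l)‖ := by
  rw [LinearMap.toMatrixOrthonormal_apply_apply]
  calc ‖⟪b i, A (b l)⟫_ℂ‖ ≤ ‖b i‖ * ‖A (b l)‖ := norm_inner_le_norm _ _
    _ = ‖A (b l)‖ := by rw [b.orthonormal.1 i, one_mul]

/-- **ENTRIES ARE INNER PRODUCTS** (re-export of Mathlib's formula in the shape the sequel uses): `M i l = ⟪b i, A (b l)⟫`. [folklore] -/
theorem toMatrixOrthonormal_apply_eq_inner (b : OrthonormalBasis ι ℂ E) (A : E →ₗ[ℂ] E) (i l : ι) :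
    LinearMap.toMatrixOrthonormal b A i l = ⟪b i, A (b l)⟫_ℂ :=
  LinearMap.toMatrixOrthonormal_apply_apply b A i l

end Bridge

end Summit.QuantumFields.YangMills.Theorems.Prop7SiteEntryCoordinates

end
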